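import Mathlib

/-!
# Energy form of Gaussian domination ⇒ second-order (susceptibility) bound — the linear algebra

Solo-blind programme (AtomisticToContinuum / BoseEinsteinCondensation), paper §12.8, Proposition 12.8(b) and the
remark "HC-GD ⟺ linear stability of `m = 0`".  The zero-temperature energy form of Gaussian domination reads
`inf spec (H − D(h)) ≥ E₀ − ½|h|²`; inserting the trial state `Ψ + εφ` and letting `ε → 0` leaves, on the orthogonal
complement of the ground state, the family of inequalities `2⟨v, φ⟩ − ⟨φ, A φ⟩ ≤ c` for all `φ`, with `A = H − E₀ > 0`
there, `v = D(h)Ψ`, `c = ½|h|²`.  The content of "optimising over `φ`" is the following exact evaluation of the supremum of a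
concave quadratic: for a symmetric positive semidefinite `A` with inverse `B`,
`(∀ φ, 2⟨v,φ⟩ − ⟨φ,Aφ⟩ ≤ c) ↔ ⟨v, B v⟩ ≤ c`, i.e. the energy form is EQUIVALENT, at second order, to the resolvent
(susceptibility) bound `⟨D(h)Ψ, (H−E₀)⁻¹ D(h)Ψ⟩ ≤ ½|h|²`.  We also record the scale optimisation
`(∀ s, s·a − b ≤ ½ s² c) ↔ a² ≤ 2 b c` (`c > 0`) used to pass between the energy form along a ray and the quadratic bound.
Finite-dimensional, stated for real matrices with explicit hypotheses (symmetry, `A * B = 1`, positivity), so that no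
spectral theory is needed.
-/

namespace Summit.AtomisticToContinuum.BoseEinsteinCondensation.Theorems

open Matrix

variable {n : Type*} [Fintype n]

/-- If `A * B = 1` then `A *ᵥ (B *ᵥ v) = v`. -/
theorem mulVec_mulVec_of_mul_eq_one [DecidableEq n] (A B : Matrix n n ℝ) (hinv : A * B = 1) (v : n → ℝ) :
    A *ᵥ (B *ᵥ v) = v := by
  rw [Matrix.mulVec_mulVec, hinv, Matrix.one_mulVec]

/-- For symmetric `A`: `⟨w, A φ⟩ = ⟨A w, φ⟩`. -/
theorem dotProduct_mulVec_symm (A : Matrix n n ℝ) (hsym : Aᵀ = A) (w φ : n → ℝ) :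
    w ⬝ᵥ (A *ᵥ φ) = (A *ᵥ w) ⬝ᵥ φ := by
  rw [Matrix.dotProduct_mulVec, ← Matrix.mulVec_transpose, hsym]

/-- **Supremum of a concave quadratic (energy form ⇒ susceptibility bound).**
For a real symmetric positive semidefinite matrix `A` with (two-sided) inverse `B` (`A * B = 1`), and any `v`, `c`:
`(∀ φ, 2⟨v,φ⟩ − ⟨φ,Aφ⟩ ≤ c) ↔ ⟨v, B v⟩ ≤ c`.  The forward direction is the witness `φ = B v`; the backward direction is
completing the square `0 ≤ ⟨φ − Bv, A(φ − Bv)⟩`. -/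
theorem sup_concave_quadratic_iff [DecidableEq n] (A B : Matrix n n ℝ) (hsym : Aᵀ = A) (hinv : A * B = 1)
    (hpos : ∀ x : n → ℝ, 0 ≤ x ⬝ᵥ (A *ᵥ x)) (v : n → ℝ) (c : ℝ) :
    (∀ φ : n → ℝ, 2 * (v ⬝ᵥ φ) - φ ⬝ᵥ (A *ᵥ φ) ≤ c) ↔ v ⬝ᵥ (B *ᵥ v) ≤ c := by
  have hABv : A *ᵥ (B *ᵥ v) = v := mulVec_mulVec_of_mul_eq_one A B hinv v
  -- ⟨Bv, A(Bv)⟩ = ⟨v, Bv⟩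
  have hw : (B *ᵥ v) ⬝ᵥ (A *ᵥ (B *ᵥ v)) = v ⬝ᵥ (B *ᵥ v) := by
    rw [hABv, dotProduct_comm]
  constructor
  · intro h
    have := h (B *ᵥ v)
    rw [hw] at this
    linarith
  · intro h φ
    set w := B *ᵥ v with hwdef
    have h0 : 0 ≤ (φ - w) ⬝ᵥ (A *ᵥ (φ - w)) := hpos (φ - w)
    -- expand the square
    have hexp : (φ - w) ⬝ᵥ (A *ᵥ (φ - w)) =
        φ ⬝ᵥ (A *ᵥ φ) - φ ⬝ᵥ (A *ᵥ w) - w ⬝ᵥ (A *ᵥ φ) + w ⬝ᵥ (A *ᵥ w) := by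
      rw [Matrix.mulVec_sub, sub_dotProduct, dotProduct_sub, dotProduct_sub]
      ring
    have h1 : φ ⬝ᵥ (A *ᵥ w) = v ⬝ᵥ φ := by rw [hABv, dotProduct_comm]
    have h2 : w ⬝ᵥ (A *ᵥ φ) = v ⬝ᵥ φ := by rw [dotProduct_mulVec_symm A hsym, hABv]
    have h3 : w ⬝ᵥ (A *ᵥ w) = v ⬝ᵥ (B *ᵥ v) := hw
    rw [hexp, h1, h2, h3] at h0
    linarith

/-- **Scale optimisation.** For `c > 0`: `(∀ s, s·a − b ≤ ½ s² c) ↔ a² ≤ 2 b c`.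
(Energy form along the ray `h = s·h₀` versus the quadratic bound; forward: `s = a / c`, backward: AM–GM.) -/
theorem ray_bound_iff (a b c : ℝ) (hc : 0 < c) :
    (∀ s : ℝ, s * a - b ≤ (1 / 2) * s ^ 2 * c) ↔ a ^ 2 ≤ 2 * b * c := by
  have hc' : c ≠ 0 := hc.ne'
  constructor
  · intro h
    have h1 := h (a / c)
    have h2 : (a / c * a - b) * c ≤ ((1 / 2) * (a / c) ^ 2 * c) * c :=
      mul_le_mul_of_nonneg_right h1 hc.le
    have e1 : (a / c * a - b) * c = a ^ 2 - b * c := by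
      field_simp
    have e2 : ((1 / 2) * (a / c) ^ 2 * c) * c = (1 / 2) * a ^ 2 := by
      field_simp
    rw [e1, e2] at h2
    linarith
  · intro h s
    nlinarith [sq_nonneg (s * c - a), h, hc, mul_pos hc hc]

end Summit.AtomisticToContinuum.BoseEinsteinCondensation.Theorems
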